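import Summits.QuantumFields.YangMills.Theorems.BalabanUVNodesN19RateEdgeHolderD4
import Summits.QuantumFields.YangMills.Theorems.BalabanUVNodesSpineReadingOfRecord13CoPHV

/-!
# BalabanUVNodes ∕ N19 — K3⁷ v2's N19′ SLOT AT dag-n20-d's SPINE READING OF RECORD WITH THE PHYSICAL VOLUME LETTER `crOfRecord₁₃VAt K₀ jcut sh`
# (`vol := F.side ^ 4`): the (ii-m) reference ledger READ ON THE FAMILY's OWN LATTICES — four more conjuncts of the link reading discharged BY NAME
# (dag-n19-w3's `latticeLetters_family`) — and the slot's conclusion with the reading's OWN canonical rate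

Cell `pub-ymgap`, HUMAN RULING D-0062 (Track A) + D-0149 (work-bound push, director-ym №197), R134 ACCELERATION seat `pub-ymgap-dag-n19-d`
(N19 NE7, strategy s2 = by-name knit at the record), generation g23; bus INTENT-K.  Route `Summits/QuantumFields/YangMills/Theses/BalabanUVNodes.lean` rev 25,
cluster item K3⁷ «SpineGivenEndpointR13SepCoPH» (stmt-QuantumFields-20544), plan g79's skeleton v2 145a664ea9c38a7b (N19′'s slot `KeyedCoreEdgeHolderD4 β cr
(rrOfRecord 𝔯 ksel)`, rates predicate `PHolderD4 β`); filed `--kind proof --supports` that item `--as helper` (it proves no registered stub).  COUNT-NEUTRAL.  THEOREMS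
ONLY; 0 `def`; 0 `sorry`; `N`-generic, guard-generic `G`; NO Theses import.  Imports the sibling J `…N19RateEdgeHolderD4` (§1 `h19HolderD4_datumOfRecord₁₃CoPH_of_linkReading`,
reading-generic) and dag-n20-d's V edition `…SpineReadingOfRecord13CoPHV` (`crOfRecord₁₃VAt K₀ jcut sh : SpineReading₁₃CoPH N`, `vol := F.side ^ 4`; dictionary and
transfers `…VAt`) — CITED BY NAME, none edited.  WHY A V READING: at v1.0's `crOfRecord₁₃At` (`vol := 1`, immutable once landed) the (ii-m) clause `(Fintype.card (Site (Pf K)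
(Pf K).K) : ℝ) = S.vol` of N19's link reading admits no family lattice (this seat's located point, pub-ymgap INBOX l.25098; ref-K WATCH-VOL-PIN; dag-n20-d's correction
l.25464 = the V edition); at `crOfRecord₁₃VAt` it holds for the family's own lattices by dag-n19-w3's `latticeLetters_family` (`S.vol = F.side ^ 4` by `rfl`).

WHAT THIS FILE PROVES (`S := crOfRecord₁₃VAt K₀ jcut sh F θ hP g₀ os`, `R := rateCarriersOfRecord₁₃CoPH 𝔯 F θ hP g₀ os k`, `D := datumOfRecord₁₃CoPH F N θ hP`).
* ★★ `h19HolderD4_crOfRecord₁₃VAt_of_linkReading` — IF the link reading `hlink` of THIS file holds (J's shorter θ-keyed block at `S`, with the (ii-m) reference-ledger letters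
  PINNED TO THE FAMILY: `Pf K := F.P (Koff + K)`, `d₀ := 4`, `L₀ := F.L`, NODE O's `cells : (K j : ℕ) → R.u3.C.Dom → Finset (Site (F.P (Koff + K)) j)`; the four lattice clauses
  `(Pf K).d = d₀`, `(Pf K).L = L₀`, `(Pf K).K = Koff + K`, `card (Site (Pf K) (Pf K).K) = S.vol` REMOVED — eleven of v9's conjuncts are now gone in all) THEN at every guarded
  admissible tuple, every `g₀ os k`: `PHolderD4 β D R` (spelled out) `→ ∃ δ, NE7.Core S.l₀ S.vol S.T S.Bad (S.A − S.shA) (S.B − S.shB) δ ∧ Summable δ`.  Proof: J's §1 at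
  `cr := crOfRecord₁₃VAt K₀ jcut sh`, J's block REASSEMBLED from this one plus `latticeLetters_family F Koff` (staged `obtain`s; one anonymous constructor).
* ★ `core_crOfRecord₁₃VAt_of_linkReading_of_shellWeightBound` — the same with the reading's OWN canonical rate `S.δ` (`core_crOfRecord₁₃VAt`; sign from any shell witness,
  `core_nonneg_of_shellWeightBound`): `NE7.Core … S.δ ∧ Summable S.δ` — the summability a COROLLARY of the edge (ref-B PIN-N19-DELTAOFRECORD reading rule).
* ★★ `keyedCoreEdgeHolderD4_crOfRecord₁₃VAt_of_linkReading` — §1 at `k := ks F θ hP g₀ os`: at `N = 2`, `G :=` the item guard, LITERALLY v2's slot text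
  `KeyedCoreEdgeHolderD4 β (crOfRecord₁₃VAt K₀ jcut sh) (rrOfRecord 𝔯 ks)` unfolded (`K₀ := 0` = `crOfRecord₁₃V jcut sh`, the `PinnedAtLive` witness plan g79 names for a v3).
N19's displayed residual AT THE V READING: NODE O's ledger world (i)∕(ii-m: `kappa₀ 64 8 ≤ R.u3.κ` + the three `cells` clauses on the family's lattices)∕(ii-v-A∕B)∕(ii-d),
[III] Thm 2 (2.43) letters (N11), N14's positional count, the (v′-16) N16 letters, (v′-17)'s run letters ∕ infrared pin ∕ `EventualLowerH` ∕ smallness ∕ `0 < ρ` ∕ `ρ ≤ θc` ∕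
box, (T)'s `DecayBound` ∕ pair discs ∕ constants ∕ upper running ∕ windows ∕ selector, `θ.γ² ≤ e⁻¹`.

HONEST FRAMING.  Count-neutral kernel bookkeeping; `hlink` is a HYPOTHESIS (NODE O's world, K2⁷; 0 instances in the tree); the rates predicate is the slot's own hypothesis;
the shell witness `hsh` a HYPOTHESIS; `K₀ jcut sh 𝔯 G ks` PARAMETERS (`sh` NOT inhabited — NODE O ∕ N21).  NOT a proof of `stub_expansion13H`.  NE7 for Bałaban's two runs
is NOT PRINTED and NOT proved; nothing of Bałaban's is asserted or instantiated (K0⁷ OPEN); N19 NOT discharged; K3⁷ NOT claimed; Track A count unmoved (typed 28∕28 ·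
discharged 5∕27 · A 5∕28).  One finite four-torus at fixed ε, rung (B)+1 — NOT infinite volume, NOT OS on ℝ⁴, NOT a mass gap, NOT Clay.  Standard axioms.  Supersedes
nothing; edits nothing.  Shape reference: [Balaban1988Convergent] Thm 2 (2.43) p.263 (the NAME of the displayed hypothesis `B14.Thm2Printed` — nothing asserted).
-/

set_option autoImplicit false

noncomputable section

open Finset MeasureTheory
open scoped BigOperators Matrix Matrix.Norms.L2Operator

namespace Summit.QuantumFields.YangMills.BalabanUVNodes.N19RateEdgeHolderD4AtSpineReadingV

open Literature.MathematicalPhysics.QuantumFieldTheory.Balaban1983to89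
open T4OutputRate T4RecentScale T4GoodClassBudget T4CauchySum T4TowerRateComposition T4TowerRateDischarge
open T4EtaRateMin (Readings NE3Shape)
open T4RateLiaison (GaugeDominated)
open T4CouplingMatching (EventualLowerH)
open FlowStep (RGEqH)
open TreeLengthTorus (TFaceConnected torusTreeLen)
open B12TreeDecay (kappa₀)
open Summit.QuantumFields.BalabanUV.T4Continuum
open AveragingDeficitDualResidual (dualC1 dualC2)
open AveragingDeficitDerivWallProof (wallConst)
open AveragingDeficitPeriodicCounting (IsPeriodicDir)
open MinimalActionSandwich (IsMinimiser minAct)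
open MinimalActionRate (sfClass)
open MinimalActionRefine (RegularSup gradConst)
open NE3EnergyShapes (IsUnitarySite IsPeriodicSite)
open NE3.LeafIndexSockets (LeafH3sup)
open Summit.QuantumFields.BalabanUV.T4Continuum.Spine
open Summit.QuantumFields.BalabanUV.T4Continuum.NE1p.DressedRoot (DressedTower DressedStabilityStrict)
open Summit.QuantumFields.YangMills.BalabanUVNodes.N19LedgerLinkSync (LedgerDataSync LedgerAtSync)
open YMDAG.UVSplit (SpineCarriers SpineRecordPred InputsPred U3Carriers RateCarriers RateRecordPred N14At N18At N22At ReadOutAt)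
open Summit.QuantumFields.YangMills.BalabanUVNodes.N16HolderDefs (CovRootHolder N16HolderAt)
open Summit.QuantumFields.YangMills.BalabanUVNodes.SpineRatesHolder (RatesHolderAt)
open Literature.MathematicalPhysics.QuantumFieldTheory.Balaban1983to89.T4Continuum (T4Family ULoop)
open T4WeightBudget (RelWeightBound)
open T4IndicatorShell (ShellWeightBound)
open T4ContinuumYM4Torus (ForSmallCouplings)
open T4ApexHybrid (HybridNE7Under)
open YMDAG.UVSplit (Datum RateReading₁₃CoPH rateCarriersOfRecord₁₃CoPH)
open YMDAG.UVSplit (SpineReading₁₃CoPH ShellSplit₁₃CoPH crOfRecord₁₃VAt classSet₁₃ weightA₁₃ weightB₁₃ badClass₁₃ core_crOfRecord₁₃VAt)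
open Node00 (Stage13HParams datumOfRecord₁₃CoPH SiteSeqKey)
open Summit.QuantumFields.YangMills.BalabanUVNodes.SpineCanonicalWeights (core_nonneg_of_shellWeightBound)
open Summit.QuantumFields.YangMills.BalabanUVNodes.N19RateEdgeRecordRunLetters (latticeLetters_family)
open Summit.QuantumFields.YangMills.BalabanUVNodes.N19RateEdgeHolderD4 (h19HolderD4_datumOfRecord₁₃CoPH_of_linkReading)

/-! ## §1 The link reading AT THE V READING with the reference ledger on the family's lattices ⇒ the slot's conclusion -/

section AtReadingV

variable {N : ℕ} [NeZero N] (K₀ : ℕ) (jcut : ℕ → ℕ) (sh : ShellSplit₁₃CoPH N K₀)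
  (𝔯 : RateReading₁₃CoPH N) (G : ∀ {F : T4Family}, Stage13HParams F N → Prop) {β : ℝ} (hβ1 : β ≤ 1)
  (hlink : ∀ (F : T4Family) (θ : Stage13HParams F N) (hP : θ.Provisos₁₃CoPH F N), G θ → θ.Admissible F N →
    ∀ (g₀ : ℕ → ℝ) (os : List (ULoop F)) (k : ℕ),
      let S : SpineCarriers := crOfRecord₁₃VAt K₀ jcut sh F θ hP g₀ os
      let R : RateCarriers N := rateCarriersOfRecord₁₃CoPH 𝔯 F θ hP g₀ os k
      let D : Datum F N := datumOfRecord₁₃CoPH F N θ hP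
      letI := S.dec
      -- the tuple's window letter (replaces (T)'s clause over `R.u3.W`; dag-n19-w3 `window_rateCarriersOfRecord₁₃CoPH_sq_le_exp_neg_one`)
      θ.γ ^ 2 ≤ Real.exp (-1) ∧
      ∃ (_ : DecidableEq R.u3.C.Dom) (F' : Type) (ι' X' : Type) (_ : MeasurableSpace ι')
        (L : LedgerDataSync R.u3.C F' ι' S.ι) (Rd : Readings ι' X') (bsel : (ℕ → ℝ) → ℝ) (EB : Functional R.u3.C R.u3.C.BgB)
        (θc θ₃ : ℝ) (g : ℕ → ℕ → ℝ)
        (uA : ℕ → ι' → R.u3.C.BgA) (uB : ℕ → ι' → R.u3.C.BgB)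
        (Koff : ℕ) (cells : (K j : ℕ) → R.u3.C.Dom → Finset (Site (F.P (Koff + K)) j))
        (H033 : Flow → ℕ → Prop) (I : Type) (fam : I → B14.Sect2Data) (Lb βw : ℝ) (κ₁ : ℕ) (Gv Cl : ℝ) (K₁ : ℕ)
        (Λ₀ N₀ : ℝ) (dressed : R.u3.C.Dom → Prop) (_ : DecidablePred dressed)
        -- N16-side letters: regime, selection, reading map, NE7 route-#1 side letters, offset
        (c' t ε₁ θ γ₃ l₁ : ℝ)
        (sel : ℕ → (B7Prop1Explicit.Site 4 → Fin 4 → (Matrix (Fin N) (Fin N) ℂ)ˣ) → (B7Prop1Explicit.Site 4 → Fin 4 → (Matrix (Fin N) (Fin N) ℂ)ˣ))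
        (rd : ι' → (B7Prop1Explicit.Site 4 → Fin 4 → (Matrix (Fin N) (Fin N) ℂ)ˣ)) (k₀ : ℕ)
        -- N17-side letters: infrared pin, β-window
        (gIR bβ : ℝ) (k₀β : ℕ)
        -- TUBE letters of the bracket (T): the (1.18) constant, the layer factor and (2.28)'s `C₁, q₁`, the flow's `β′`
        (E₀T κ₁T C₁T β'T : ℝ) (q₁ : ℕ),
        -- the run-B functional is the first-coupling family read through the selector
        EB = (fun s => R.u3.EB (bsel s) s) ∧
        -- (i) the ledger predicate for whatever size data and census constants meet their clauses
        (∀ (Sz : ℕ → ℝ → S.ι → ℕ → ℝ) (E₀ : ℝ) (m : ℕ) (a : ℝ) (Cw Λg : ℝ),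
          (∀ K t, |t| ≤ S.l₀ → ∀ τ ∈ S.T K \ S.Bad K t, ∀ v ∈ Rd.dom, ∀ j ≤ K,
            |∑ X ∈ L.fac K t τ with R.u3.C.scale X = j,
                (Real.log (Real.exp (EB (fun i => g (K + 1) (i + 1)) (uB K v) X
                    - EB (fun i => g (K + 1) (i + 1)) L.oneB X))
                  - Real.log (Real.exp (R.u3.EA (g K) (uA K v) X - R.u3.EA (g K) L.oneA X)))| ≤ Sz K t τ j) →
          0 ≤ E₀ → 0 < a → a < 1 →
          (∀ K t, |t| ≤ S.l₀ → ∀ τ ∈ S.T K \ S.Bad K t, ∀ j ≤ K,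
            Sz K t τ j ≤ S.vol * (E₀ * ((K : ℝ) + 1) ^ m * a ^ (K - j))) →
          (∀ K, Multiplicity (L.All K) R.u3.C.scale (fun X => Real.exp (-(R.u3.κ * R.u3.C.d X))) Cw S.vol Λg K) →
          (∀ K t, |t| ≤ S.l₀ → ∀ τ ∈ S.T K \ S.Bad K t,
            WindowMultiplicity (L.facO K t τ) L.scO L.wO Cw S.vol Λg (jlogOf L.Cl K) K) →
          1 ≤ Λg → L.θ' ≤ Λg →
          LedgerAtSync { L with S := Sz, E₀ := E₀, m := m, a := a, Cw := Cw, Λg := Λg } S.l₀ S.vol S.T S.Bad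
            (fun K t τ => S.A K t τ - S.shA K t τ) (fun K t τ => S.B K t τ - S.shB K t τ) Rd R.u3.EA EB R.u3.κ g uA uB
            R.u3.ω θc R.u3.θ θ₃) ∧
        0 ≤ S.vol ∧
        (∀ K t, |t| ≤ S.l₀ → ∀ τ ∈ S.T K \ S.Bad K t,
          WindowMultiplicity (L.facO K t τ) L.scO L.wO L.Cw S.vol L.Λg (jlogOf L.Cl K) K) ∧
        0 ≤ L.Cw ∧ 1 ≤ L.Λg ∧ L.θ' ≤ L.Λg ∧
        -- (ii-m) the reference ledger ON THE FAMILY's OWN LATTICES `F.P (Koff + K)` (the four lattice clauses of v9 hold by dag-n19-w3's `latticeLetters_family`; `d₀ = 4`)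
        kappa₀ (4 * 2 ^ 4) (2 * 4) ≤ R.u3.κ ∧
        (∀ K, ∀ X ∈ L.All K,
          (cells K (R.u3.C.scale X + Koff) X).Nonempty ∧ TFaceConnected (cells K (R.u3.C.scale X + Koff) X)) ∧
        (∀ K j, Set.InjOn (cells K j) ↑((L.All K).filter fun X => R.u3.C.scale X + Koff = j)) ∧
        (∀ K, ∀ X ∈ L.All K, torusTreeLen (cells K (R.u3.C.scale X + Koff) X) ≤ R.u3.C.d X) ∧
        -- (iii) [III] Theorem 2 (2.43) AS PRINTED with window letters
        B14.Thm2Printed H033 fam Lb βw κ₁ ∧ βw < 1 ∧ 0 < βw ∧ 1 < Lb ∧ 1 ≤ Gv ∧ 0 ≤ Cl ∧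
        -- (iv) the positional-count half of N14's pinned pair at a rate `≤ R.ne1.Λ`
        (∀ p K, (R.ne1.𝒯.B p K).PositionalCount fun j k => N₀ * Λ₀ ^ (k - j)) ∧ 0 ≤ N₀ ∧ 0 ≤ Λ₀ ∧ Λ₀ ≤ R.ne1.Λ ∧
        -- (ii-v-A) run A's vacuum slices ↔ printed E-terms
        (∀ K t, |t| ≤ S.l₀ → ∀ τ ∈ S.T K \ S.Bad K t, ∀ v ∈ Rd.dom, ∀ j ≤ K, ∃ (i : I) (w : (fam i).Ω) (j' : ℕ),
          (fam i).flow.SatisfiesRG (fam i).K ∧ H033 (fam i).flow (fam i).K ∧ 1 ≤ j' ∧ j' ≤ (fam i).K ∧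
          (fam i).K - j' = K - j ∧ (fam i).K ≤ K + K₁ ∧
          (∀ n, 0 ≤ (fam i).gammaVol n w) ∧ (fam i).gammaVol (fam i).K w ≤ S.vol ∧
          (∀ n, n < (fam i).K → n < jlogOf Cl (fam i).K → (fam i).gammaVol n w = 0) ∧
          (∀ n, n < (fam i).K → jlogOf Cl (fam i).K ≤ n → (fam i).gammaVol n w ≤ S.vol * Gv ^ ((fam i).K - n)) ∧
          |∑ X ∈ (L.fac K t τ).filter (fun X => ¬ dressed X) with R.u3.C.scale X = j,
              (R.u3.EA (g K) (uA K v) X - R.u3.EA (g K) L.oneA X)| ≤ |(fam i).eTerm j' (fam i).K w|) ∧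
        -- (ii-v-B) run B's vacuum slices ↔ printed E-terms
        (∀ K t, |t| ≤ S.l₀ → ∀ τ ∈ S.T K \ S.Bad K t, ∀ v ∈ Rd.dom, ∀ j ≤ K, ∃ (i : I) (w : (fam i).Ω) (j' : ℕ),
          (fam i).flow.SatisfiesRG (fam i).K ∧ H033 (fam i).flow (fam i).K ∧ 1 ≤ j' ∧ j' ≤ (fam i).K ∧
          (fam i).K - j' = K - j ∧ (fam i).K ≤ K + K₁ ∧
          (∀ n, 0 ≤ (fam i).gammaVol n w) ∧ (fam i).gammaVol (fam i).K w ≤ S.vol ∧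
          (∀ n, n < (fam i).K → n < jlogOf Cl (fam i).K → (fam i).gammaVol n w = 0) ∧
          (∀ n, n < (fam i).K → jlogOf Cl (fam i).K ≤ n → (fam i).gammaVol n w ≤ S.vol * Gv ^ ((fam i).K - n)) ∧
          |∑ X ∈ (L.fac K t τ).filter (fun X => ¬ dressed X) with R.u3.C.scale X = j,
              (EB (fun i => g (K + 1) (i + 1)) (uB K v) X - EB (fun i => g (K + 1) (i + 1)) L.oneB X)|
            ≤ |(fam i).eTerm j' (fam i).K w|) ∧
        -- (ii-d) the dressed sub-ledger ↔ N14's bookings on `R.ne1.𝒯`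
        (∀ K t, |t| ≤ S.l₀ → ∀ τ ∈ S.T K \ S.Bad K t, ∀ v ∈ Rd.dom,
          ∃ (pA : R.ne1.P) (βA : R.u3.C.Dom → (R.ne1.𝒯.B pA K).Birth) (Q : Finset (R.ne1.𝒯.B pA K).Cube) (pB : R.ne1.P)
            (KB : ℕ) (βB : R.u3.C.Dom → (R.ne1.𝒯.B pB KB).Birth),
          (∀ X ∈ (L.fac K t τ).filter (fun X => dressed X), (R.ne1.𝒯.B pA K).birthScale (βA X) = R.u3.C.scale X) ∧
          (∀ j, Set.InjOn βA ↑(((L.fac K t τ).filter (fun X => dressed X)).filter fun X => R.u3.C.scale X = j)) ∧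
          (∀ c ∈ Q, (R.ne1.𝒯.B pA K).cubeScale c = K) ∧ ((Q.card : ℝ) ≤ S.vol) ∧
          (∀ X ∈ (L.fac K t τ).filter (fun X => dressed X), ∃ c ∈ Q, βA X ∈ (R.ne1.𝒯.B pA K).feltAt c) ∧
          (∀ X ∈ (L.fac K t τ).filter (fun X => dressed X), KB - (R.ne1.𝒯.B pB KB).birthScale (βB X) = K - R.u3.C.scale X) ∧
          (∀ X ∈ (L.fac K t τ).filter (fun X => dressed X),
            |R.u3.EA (g K) (uA K v) X - R.u3.EA (g K) L.oneA X| ≤ (R.ne1.𝒯.B pA K).size (βA X) K) ∧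
          (∀ X ∈ (L.fac K t τ).filter (fun X => dressed X),
            |EB (fun i => g (K + 1) (i + 1)) (uB K v) X - EB (fun i => g (K + 1) (i + 1)) L.oneB X|
              ≤ (R.ne1.𝒯.B pB KB).size (βB X) KB)) ∧
        -- (v′-16) N16 BY NAME: THE END's regime letters of `R.ne3`, N07's interface, the selection, NE7 route-#1's side letters, the
        -- reading map, the action-reading identification, the offset, the gauge-domination convention
        R.ne3.g = gradConst 4 c' ∧ 1 ≤ R.ne3.Nper ∧ 0 ≤ R.ne3.b ∧ 0 ≤ c' ∧ R.ne3.b ≤ t ∧ c' ≤ t ∧ 0 ≤ R.ne3.C ∧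
        (2 : ℝ) ^ 91 * (R.ne3.L : ℝ) ^ 17 * t ≤ 1 ∧ (2 : ℝ) ^ 76 * (R.ne3.L : ℝ) ^ 12 * t ≤ R.ne3.ε ∧
        16 * B7Prop2Explicit.C0 4 * R.ne3.ε ≤ 3 ∧ 1024 * (4 + 1) * (4 + 4) * (R.ne3.L : ℝ) ^ 2 * R.ne3.ε ≤ 1 ∧
        ε₁ ≤ 1 / 4 ∧ ε₁ ≤ R.ne3.b ∧ 4 * ε₁ ≤ c' ∧ R.ne3.dom ⊆ sfClass 4 R.ne3.L R.ne3.Nper ε₁ 0 ∧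
        LeafH3sup 4 R.ne3.L R.ne3.Nper R.ne3.ε R.ne3.b c' R.ne3.dom ∧
        (∀ V ∈ R.ne3.dom, ∀ k : ℕ, IsMinimiser 4 (sfClass 4 R.ne3.L R.ne3.Nper R.ne3.ε) R.ne3.L R.ne3.Nper k V (sel k V)) ∧
        (∀ V ∈ R.ne3.dom, ∀ k : ℕ, RegularSup 4 R.ne3.L R.ne3.Nper R.ne3.b c' k (sel k V)) ∧
        0 < θ ∧ θ ^ 6 = ((R.ne3.L : ℝ))⁻¹ ∧ 0 < R.ne3.Λ₂' ∧ 0 < γ₃ ∧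
        R.ne3.C * (wallConst 4 R.ne3.L * (R.ne3.Nper : ℝ) ^ 2 *
          (Real.sqrt (gradConst 4 c') * dualC2 4 R.ne3.L + 2 * R.ne3.b ^ 2 * dualC1 4 R.ne3.L)) ≤ γ₃ ^ 3 ∧
        0 < l₁ ∧ R.ne3.Λ₁ ≤ l₁ ^ 3 ∧ γ₃ * θ ^ 2 ≤ l₁ * R.ne3.Nper ∧ θ ^ ((3 : ℝ) * β - 2) ≤ θ₃ ∧ θ₃ < 1 ∧
        (∀ v ∈ Rd.dom, rd v ∈ R.ne3.dom) ∧
        (∀ k, ∀ v ∈ Rd.dom, Rd.act k v = minAct 4 (sfClass 4 R.ne3.L R.ne3.Nper R.ne3.ε) R.ne3.L R.ne3.Nper k (rd v)) ∧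
        (R.ne3.Nper : ℝ) ^ 4 ≤ Rd.vol ∧ 1 ≤ k₀ ∧
        (∀ K : ℕ, ∀ v ∈ Rd.dom, ∀ (u : B7Prop1Explicit.Site 4 → (Matrix (Fin N) (Fin N) ℂ)ˣ)
          (Z : B7Prop1Explicit.Site 4 → Fin 4 → Matrix (Fin N) (Fin N) ℂ) (M : ℝ),
          IsUnitarySite u → IsPeriodicSite u ((R.ne3.Nper * R.ne3.L ^ (k₀ + K) : ℕ) : ℤ) → T4AveragingDeficitWall.IsSkewDir Z →
          IsPeriodicDir Z ((R.ne3.Nper * R.ne3.L ^ (k₀ + K) : ℕ) : ℤ) →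
          B7Prop1Explicit.gaugeAct u (sel (k₀ + K) (rd v)) =
            T4AveragingDeficitWall.vary (B7Prop2Explicit.rescale R.ne3.L (B7Prop1Explicit.bavg R.ne3.L (sel (k₀ + K + 1) (rd v)))) Z 1 →
          (∀ (x : B7Prop1Explicit.Site 4) (κ : Fin 4), (R.ne3.L : ℝ) ^ (k₀ + K) * ‖Z x κ‖ ≤ M) →
          (∀ (x : B7Prop1Explicit.Site 4) (μ κ : Fin 4), ((R.ne3.L : ℝ) ^ (k₀ + K)) ^ 2 *
              ‖T4AveragingDeficitWall.Ad (B7Prop2Explicit.rescale R.ne3.L (B7Prop1Explicit.bavg R.ne3.L (sel (k₀ + K + 1) (rd v)))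
                  (x + B7Prop1Explicit.e κ) μ) (Z (x + B7Prop1Explicit.e μ) κ) - Z x κ‖ ≤ M) →
          R.u3.C.gauge (uA K v) (R.u3.C.transport (uB K v)) ≤ M) ∧
        -- (v′-17) N17 BY NAME: the (0.20)-run identification, the infrared pin, the β-window, the smallness window, rates
        (∀ K, RGEqH K D.βfun (g K)) ∧ (∀ K, g K K = gIR) ∧ 0 < bβ ∧
        EventualLowerH bβ R.u3.γ k₀β D.βfun ∧
        R.u3.cr * R.u3.C₉ * R.u3.ω * (((k₀β : ℝ) + 1) * R.u3.γ ^ 3 + 2 * R.u3.γ / bβ) ≤ (1 - R.u3.ρ) / 2 ∧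
        0 < R.u3.ρ ∧ R.u3.ρ ≤ θc ∧
        -- the box
        (∀ K i, i ≤ K → 0 < g K i ∧ g K i ≤ R.u3.γ) ∧
        -- the bracket (T) IN THE TUBE CURRENCY (`N19LipBracketTube.lipBracket_at_rateCarriers_of_pairDisc`'s inputs): the (1.18) real
        -- bound; the pair-disc shape at the printed tube radius κ₁·α(C₁, q₁, s_j) ((2.27)(ii)(iv) through the (1.13)∕(2.39) tube — SHAPE,
        -- NODE O); signs; the window's smallness; the UPPER running of the tables ((2.6) ∕ (0.31) upper half, β-side conditional, DISPLAYED)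
        DecayBound R.u3.EA R.u3.W E₀T R.u3.κ ∧
        (∀ s ∈ R.u3.W, ∀ (X : R.u3.C.Dom) (U U' : R.u3.C.BgA),
          R.u3.C.gauge U U' < κ₁T * B14.alphaJ C₁T q₁ (s (R.u3.C.scale X)) →
          ∃ f : ℂ → ℂ, DifferentiableOn ℂ f (Metric.ball (0 : ℂ) (κ₁T * B14.alphaJ C₁T q₁ (s (R.u3.C.scale X)))) ∧
            f 0 = (R.u3.EA s U X : ℂ) ∧ f (R.u3.C.gauge U U' : ℂ) = (R.u3.EA s U' X : ℂ) ∧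
            ∀ z ∈ Metric.ball (0 : ℂ) (κ₁T * B14.alphaJ C₁T q₁ (s (R.u3.C.scale X))),
              ‖f z‖ ≤ E₀T * Real.exp (-(R.u3.κ * R.u3.C.d X))) ∧
        0 ≤ E₀T ∧ 0 < κ₁T ∧ 0 < C₁T ∧
        (∀ K j, j ≤ K → 1 / g K j ^ 2 ≤ 1 / gIR ^ 2 + β'T * ((K : ℝ) - j)) ∧ 0 ≤ β'T ∧
        -- window memberships, selector compatibility
        (∀ K, g K ∈ R.u3.W) ∧ (∀ K, (fun i => g (K + 1) (i + 1)) ∈ R.u3.W) ∧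
        (∀ s ∈ R.u3.W, 0 < bsel s ∧ bsel s ≤ R.u3.γ))

include hβ1 hlink

/-- ★★ **K3⁷ v2's N19′ SLOT AT THE V READING, THE REFERENCE LEDGER ON THE FAMILY's LATTICES** [bookkeeping]: at every guarded admissible Stage-13 tuple, every
`g₀ os k`: `RatesHolderAt D R β ∧ ReadOutAt D R.u3 ∧ (0 ≤ R.u3.ρ ∧ R.u3.ρ < 1)` (plan g79's `PHolderD4 β D R`) `→ ∃ δ, NE7.Core S.l₀ S.vol S.T S.Bad (S.A − S.shA) (S.B − S.shB) δ ∧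
Summable δ` for `S := crOfRecord₁₃VAt K₀ jcut sh F θ hP g₀ os` (dag-n20-d's V edition, `S.vol = F.side ^ 4` by `rfl`), `R := rateCarriersOfRecord₁₃CoPH 𝔯 F θ hP g₀ os k`,
`D := datumOfRecord₁₃CoPH F N θ hP`.  Here `hlink` is the sibling J's shorter θ-keyed block at this `S` with FOUR MORE conjuncts gone: the (ii-m) letters `Pf`, `d₀`, `L₀` are
PINNED to the family (`Pf K := F.P (Koff + K)`, `d₀ := 4`, `L₀ := F.L`; NODE O's `cells` live on `Site (F.P (Koff + K)) j`), so `(∀ K, (Pf K).d = d₀)`, `(∀ K, (Pf K).L = L₀)`,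
`(∀ K, (Pf K).K = Koff + K)` and `(∀ K, (Fintype.card (Site (Pf K) (Pf K).K) : ℝ) = S.vol)` are dag-n19-w3's `latticeLetters_family F Koff` (the last at `S.vol = F.side ^ 4`,
definitional) — inhabitable ONLY at the V reading (at `crOfRecord₁₃At`, `vol := 1`, no family lattice meets it; pub-ymgap INBOX l.25098, ref-K WATCH-VOL-PIN).  Proof: J's §1
at `cr := crOfRecord₁₃VAt K₀ jcut sh`, its block REASSEMBLED from this one and the four lattice facts. NOT NE7; N19 NOT discharged. [folklore] -/
theorem h19HolderD4_crOfRecord₁₃VAt_of_linkReading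
    (F : T4Family) (θ : Stage13HParams F N) (hP : θ.Provisos₁₃CoPH F N) (hG : G θ) (hθ : θ.Admissible F N) (g₀ : ℕ → ℝ) (os : List (ULoop F)) (k : ℕ)
    (hP4 : RatesHolderAt (datumOfRecord₁₃CoPH F N θ hP) (rateCarriersOfRecord₁₃CoPH 𝔯 F θ hP g₀ os k) β ∧
      ReadOutAt (datumOfRecord₁₃CoPH F N θ hP) (rateCarriersOfRecord₁₃CoPH 𝔯 F θ hP g₀ os k).u3 ∧
      (0 ≤ (rateCarriersOfRecord₁₃CoPH 𝔯 F θ hP g₀ os k).u3.ρ ∧ (rateCarriersOfRecord₁₃CoPH 𝔯 F θ hP g₀ os k).u3.ρ < 1)) :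
    letI := (crOfRecord₁₃VAt K₀ jcut sh F θ hP g₀ os).dec
    ∃ δ : ℕ → ℝ, NE7.Core (crOfRecord₁₃VAt K₀ jcut sh F θ hP g₀ os).l₀ (crOfRecord₁₃VAt K₀ jcut sh F θ hP g₀ os).vol (crOfRecord₁₃VAt K₀ jcut sh F θ hP g₀ os).T
      (crOfRecord₁₃VAt K₀ jcut sh F θ hP g₀ os).Bad
      (fun K t τ => (crOfRecord₁₃VAt K₀ jcut sh F θ hP g₀ os).A K t τ - (crOfRecord₁₃VAt K₀ jcut sh F θ hP g₀ os).shA K t τ)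
      (fun K t τ => (crOfRecord₁₃VAt K₀ jcut sh F θ hP g₀ os).B K t τ - (crOfRecord₁₃VAt K₀ jcut sh F θ hP g₀ os).shB K t τ) δ ∧
      Summable δ := by
  refine h19HolderD4_datumOfRecord₁₃CoPH_of_linkReading (crOfRecord₁₃VAt K₀ jcut sh) 𝔯 G hβ1 ?_ F θ hP hG hθ g₀ os k hP4
  intro F θ hP hG hθ g₀ os k
  -- destructure this file's reading IN STAGES, then reassemble J's block with the (ii-m) letters pinned to the family
  obtain ⟨hγe, iDom, F', ι', X', iMeas, L, Rd, bsel, EB, θc, θ₃, g, uA, uB, hrest⟩ := hlink F θ hP hG hθ g₀ os k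
  obtain ⟨Koff, cells, H033, I, fam, Lb, βw, κ₁, Gv, Cl, K₁, Λ₀, N₀, dressed, iDr, hrest⟩ := hrest
  obtain ⟨c', t, ε₁, ϑ, γ₃, l₁, sel, rd, k₀, gIR, bβ, k₀β, E₀T, κ₁T, C₁T, β'T, q₁, hrest⟩ := hrest
  obtain ⟨hEB, hL, hvol, homult, hCw, hΛg, hθΛ, hκ₀, hdom, hinj, hlen, hrest⟩ := hrest
  obtain ⟨hPd, hPL, hPK, hcard⟩ := latticeLetters_family F Koff
  exact ⟨hγe, iDom, F', ι', X', iMeas, L, Rd, bsel, EB, θc, θ₃, g, uA, uB, fun K => F.P (Koff + K), 4, F.L, Koff, cells, H033, I, fam, Lb, βw, κ₁, Gv, Cl, K₁,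
    Λ₀, N₀, dressed, iDr, c', t, ε₁, ϑ, γ₃, l₁, sel, rd, k₀, gIR, bβ, k₀β, E₀T, κ₁T, C₁T, β'T, q₁, hEB, hL, hvol, homult, hCw, hΛg, hθΛ, hPd, hPL, hPK,
    hcard, hκ₀, hdom, hinj, hlen, hrest⟩

/-- ★ **… WITH THE READING's OWN CANONICAL RATE** (sign from any shell witness — dag-n20-d `core_nonneg_of_shellWeightBound`, transfer `core_crOfRecord₁₃VAt`):
`NE7.Core S.l₀ S.vol S.T S.Bad (S.A − S.shA) (S.B − S.shB) S.δ ∧ Summable S.δ`; `Summable S.δ` a COROLLARY of the edge (ref-B PIN-N19-DELTAOFRECORD). [folklore] -/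
theorem core_crOfRecord₁₃VAt_of_linkReading_of_shellWeightBound
    (F : T4Family) (θ : Stage13HParams F N) (hP : θ.Provisos₁₃CoPH F N) (hG : G θ) (hθ : θ.Admissible F N) (g₀ : ℕ → ℝ) (os : List (ULoop F)) (k : ℕ)
    (hP4 : RatesHolderAt (datumOfRecord₁₃CoPH F N θ hP) (rateCarriersOfRecord₁₃CoPH 𝔯 F θ hP g₀ os k) β ∧
      ReadOutAt (datumOfRecord₁₃CoPH F N θ hP) (rateCarriersOfRecord₁₃CoPH 𝔯 F θ hP g₀ os k).u3 ∧
      (0 ≤ (rateCarriersOfRecord₁₃CoPH 𝔯 F θ hP g₀ os k).u3.ρ ∧ (rateCarriersOfRecord₁₃CoPH 𝔯 F θ hP g₀ os k).u3.ρ < 1)) {Wsh : ℕ → ℝ}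
    (hsh : ShellWeightBound 1 (classSet₁₃ θ K₀ g₀) (weightA₁₃ θ hP K₀ g₀ os) (weightB₁₃ θ hP K₀ g₀ os) (sh F θ hP g₀ os).1 (sh F θ hP g₀ os).2 Wsh) :
    (letI := (crOfRecord₁₃VAt K₀ jcut sh F θ hP g₀ os).dec
     NE7.Core (crOfRecord₁₃VAt K₀ jcut sh F θ hP g₀ os).l₀ (crOfRecord₁₃VAt K₀ jcut sh F θ hP g₀ os).vol (crOfRecord₁₃VAt K₀ jcut sh F θ hP g₀ os).T
       (crOfRecord₁₃VAt K₀ jcut sh F θ hP g₀ os).Bad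
       (fun K t τ => (crOfRecord₁₃VAt K₀ jcut sh F θ hP g₀ os).A K t τ - (crOfRecord₁₃VAt K₀ jcut sh F θ hP g₀ os).shA K t τ)
       (fun K t τ => (crOfRecord₁₃VAt K₀ jcut sh F θ hP g₀ os).B K t τ - (crOfRecord₁₃VAt K₀ jcut sh F θ hP g₀ os).shB K t τ)
       (crOfRecord₁₃VAt K₀ jcut sh F θ hP g₀ os).δ) ∧
      Summable (crOfRecord₁₃VAt K₀ jcut sh F θ hP g₀ os).δ := by
  obtain ⟨δ, hcore, hsum⟩ := h19HolderD4_crOfRecord₁₃VAt_of_linkReading K₀ jcut sh 𝔯 G hβ1 hlink F θ hP hG hθ g₀ os k hP4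
  letI : DecidableEq (Σ K, SiteSeqKey F (K₀ + K)) := Classical.decEq _
  exact core_crOfRecord₁₃VAt K₀ jcut sh θ hP g₀ os (core_nonneg_of_shellWeightBound hsh) hcore hsum

/-- ★★ **THE v2 SLOT TEXT AT THE V READING** (`KeyedCoreEdgeHolderD4 β (crOfRecord₁₃VAt K₀ jcut sh) (rrOfRecord 𝔯 ks)` unfolded; `K₀ := 0` is `crOfRecord₁₃V jcut sh`, the
`PinnedAtLive` witness plan g79 names for a v3): §1 at `k := ks F θ hP g₀ os`. NOT a proof of stub 2. [folklore] -/
theorem keyedCoreEdgeHolderD4_crOfRecord₁₃VAt_of_linkReading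
    (ks : (F : T4Family) → (θ : Stage13HParams F N) → θ.Provisos₁₃CoPH F N → (ℕ → ℝ) → List (ULoop F) → ℕ)
    (F : T4Family) (θ : Stage13HParams F N) (hP : θ.Provisos₁₃CoPH F N) (hG : G θ) (hθ : θ.Admissible F N) (g₀ : ℕ → ℝ) (os : List (ULoop F))
    (hP4 : RatesHolderAt (datumOfRecord₁₃CoPH F N θ hP) (rateCarriersOfRecord₁₃CoPH 𝔯 F θ hP g₀ os (ks F θ hP g₀ os)) β ∧
      ReadOutAt (datumOfRecord₁₃CoPH F N θ hP) (rateCarriersOfRecord₁₃CoPH 𝔯 F θ hP g₀ os (ks F θ hP g₀ os)).u3 ∧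
      (0 ≤ (rateCarriersOfRecord₁₃CoPH 𝔯 F θ hP g₀ os (ks F θ hP g₀ os)).u3.ρ ∧ (rateCarriersOfRecord₁₃CoPH 𝔯 F θ hP g₀ os (ks F θ hP g₀ os)).u3.ρ < 1)) :
    letI := (crOfRecord₁₃VAt K₀ jcut sh F θ hP g₀ os).dec
    ∃ δ : ℕ → ℝ, NE7.Core (crOfRecord₁₃VAt K₀ jcut sh F θ hP g₀ os).l₀ (crOfRecord₁₃VAt K₀ jcut sh F θ hP g₀ os).vol (crOfRecord₁₃VAt K₀ jcut sh F θ hP g₀ os).T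
      (crOfRecord₁₃VAt K₀ jcut sh F θ hP g₀ os).Bad
      (fun K t τ => (crOfRecord₁₃VAt K₀ jcut sh F θ hP g₀ os).A K t τ - (crOfRecord₁₃VAt K₀ jcut sh F θ hP g₀ os).shA K t τ)
      (fun K t τ => (crOfRecord₁₃VAt K₀ jcut sh F θ hP g₀ os).B K t τ - (crOfRecord₁₃VAt K₀ jcut sh F θ hP g₀ os).shB K t τ) δ ∧
      Summable δ :=
  h19HolderD4_crOfRecord₁₃VAt_of_linkReading K₀ jcut sh 𝔯 G hβ1 hlink F θ hP hG hθ g₀ os (ks F θ hP g₀ os) hP4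

end AtReadingV

end Summit.QuantumFields.YangMills.BalabanUVNodes.N19RateEdgeHolderD4AtSpineReadingV

end
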